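import Summits.HodgeConjecture.HodgeConjecture.Theorems.MarkmanPartnerTransportRMTypeOrbitModelVectors
import Summits.HodgeConjecture.HodgeConjecture.Theorems.MarkmanPartnerTransportRMTypeOrbitTransitivity
import HarnessLib

/-!
# Route MarkmanPartnerTransport · crux `PicardThreeK3Squares` (stmt-HodgeConjecture-19652) —
# «RATIONAL ORBIT DENSITY» 4/4: the orbits of the rational centraliser `G_θ(ℚ)` on `D_{θ,e}` are dense

Cell hodge-nonav, crux #4 of route MarkmanPartnerTransport (HC⁴(S ⊗ S) for projective K3 surfaces with
ρ(S) ≥ 3; open core: real multiplication). Programme «RATIONAL ORBIT DENSITY» (prover seat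
hodge-nonav-19652-p1, gen 10; `--supports stmt-HodgeConjecture-19652`, helper): the cell's moduli
programme displays, per rational real-multiplication type `θ ∈ M₂₂(ℚ)` (`…RMTypeDefs`), the input
`RMTypeDominated θ` — an `RMSpreadFamily` at EVERY `θ`-eigen period, whose intended discharge needs the
universal family over the RM component plus Deligne's invariant-cycle theorem («moduli carriers do not
exist»). The programme replaces it by the WEAKER input «`θ` is cycle-induced at the marked K3 surfaces
whose periods lie in some non-empty OPEN subset of the Hodge locus `D_{θ,e}`», through the elementary
fact proved in this series: **the rational centraliser `G_θ(ℚ) = {g ∈ O(Λ_ℚ) : gθ = θg}` has dense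
orbits on `D_{θ,e} = {y ∈ Λ_ℂ : θ_ℂ y = e y, (y.y) = 0, (ȳ.y) > 0}`**, while HC⁴ ∕ cycle-inducedness of
`θ` is `G_θ(ℚ)`-invariant by Buskin transport (the pattern of `RMTypeDescent`, p620943).

THIS FILE (fact-free): §7 APPROXIMATION — by induction on a word of reflections along non-isotropic real
`e`-eigenvectors, every neighbourhood of its value at an `e`-eigenvector `x` contains `g x` for some
`g ∈ G_θ(ℚ)` (each reflection `s_n` is replaced by `R_{θq} ⊗ ℂ`, `q ∈ Λ_ℚ` near the real coordinates of
`n`, which acts on the eigenspace as the reflection along the nearby model vector — joint continuity of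
the parametrised reflection, density of `ℚ²² ⊂ ℝ²²`); §8 the Hodge-index input `hT` from ONE rational
vector of positive square killed by `θ` (signature `(3,19)`: `finrank_le_three_of_posDef_k3`,
`apply_self_neg_of_mem_of_ortho`); §9 **`exists_ratIsometry_commute_smul_mem_of_isOpen` — RATIONAL ORBIT
DENSITY**: for `θ` self-adjoint killing a positive rational vector, `e ≠ 0` real with eigenprojector
certificate `π`, every period point `y₀ ∈ D_{θ,e}` and every open `U` meeting `D_{θ,e}`, some
`g ∈ G_θ(ℚ)` and `c ≠ 0` have `c·g(y₀) ∈ U`. Consumer: `…PicardThreeK3SquaresRMTypeOpenDescent`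
(HC⁴(S ⊗ S) for every K3 surface of a rational RM type that is cycle-induced on an OPEN SET of periods).
No named fact, no sorry; nothing here says HC is proved.

References: O'Meara, *Introduction to Quadratic Forms* (1963), §42–§43B (symmetries); Iversen,
*Hyperbolic Geometry* (1992), Ch. I §2 Prop. 2.3; Huybrechts, *Lectures on K3 Surfaces* (2016), Ch. 3
Lemma 3.1, Ch. 6 Prop. 1.5 and Rem. 3.3; Lang, *Algebra* (2002), Ch. XIV §2–§3, XV §6–§7, XVI §4; van
Geemen–Schütt, Forum Math. Sigma 13 (2025) e2, §2.1, §3.4; Buskin, J. reine angew. Math. 755 (2019), §6.2.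
-/

set_option linter.dupNamespace false

noncomputable section

namespace Summit.HodgeConjecture.HodgeConjecture.Theorems.MarkmanPartnerTransport.RMTypeOrbit

open Polynomial
open Literature.AlgebraicGeometry.Surfaces Literature.LinearAlgebra.QuadraticForm
open Summit.HodgeConjecture.HodgeConjecture.Theorems.MarkmanPartnerTransport.RMTypeDescent

/-! ### §7 Approximation: products of reflections along real eigenvectors are limits of elements of
the rational centraliser `G_θ(ℚ)` -/

section Density

variable {θ : Matrix K3Index K3Index ℚ} {e : ℝ} {π : ℂ[X]}

/-- `Good[θ, g]`: `g` is an isometry of `(Λ_ℂ, k3Form)` defined over `ℚ` and commuting with `θ_ℂ`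
(an element of the rational centraliser `G_θ(ℚ)`). Local notation only. -/
local notation3 (prettyPrint := false) "Good[" θ ", " g "]" =>
  ((∀ a b : K3Index → ℂ, k3Form (g a) (g b) = k3Form a b) ∧
    (∀ v : K3Index → ℤ, ∃ w : K3Index → ℚ, g (fun i => (v i : ℂ)) = fun i => (w i : ℂ)) ∧
    g ∘ₗ thetaC θ = thetaC θ ∘ₗ g)

/-- The model vector with REAL parameter: `ρ ↦ π(θ_ℂ)(θ_ℂ ρ)`. [cite: GeemenSchutt2023, §2.1] -/
def modelVecR (θ : Matrix K3Index K3Index ℚ) (π : ℂ[X]) (ρ : K3Index → ℝ) : K3Index → ℂ :=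
  aeval (thetaC θ) π (thetaC θ (fun i => (ρ i : ℂ)))

/-- At rational parameters the real-parametrised model vector is `modelVec`. [cite: GeemenSchutt2023, §2.1] -/
theorem modelVecR_ratCast (q : K3Index → ℚ) : modelVecR θ π (fun i => (q i : ℝ)) = modelVec θ π q := by
  simp only [modelVecR, modelVec, Complex.ofReal_ratCast]

/-- The model vector depends continuously on the real parameter. [folklore] -/
theorem continuous_modelVecR : Continuous (modelVecR θ π) := by
  have h1 : Continuous (fun ρ : K3Index → ℝ => (fun i => (ρ i : ℂ))) :=
    continuous_pi fun i => Complex.continuous_ofReal.comp (continuous_apply i)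
  exact ((aeval (thetaC θ) π).comp (thetaC θ)).continuous_of_finiteDimensional.comp h1

/-- The K3 form is jointly continuous. [folklore] -/
theorem continuous_k3Form₂ : Continuous (fun p : (K3Index → ℂ) × (K3Index → ℂ) => k3Form p.1 p.2) := by
  unfold k3Form
  refine continuous_finsetSum _ fun i _ => continuous_finsetSum _ fun j _ => ?_
  exact (((continuous_apply i).comp continuous_fst).mul continuous_const).mul
    ((continuous_apply j).comp continuous_snd)

/-- The reflection along the model vector, as a map of (real parameter, vector). [cite: Iversen1992, Ch. I §2 (2.1)] -/
def reflMap (θ : Matrix K3Index K3Index ℚ) (π : ℂ[X]) (p : (K3Index → ℝ) × (K3Index → ℂ)) : K3Index → ℂ :=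
  p.2 - ((2 : ℂ) / k3Form (modelVecR θ π p.1) (modelVecR θ π p.1) * k3Form (modelVecR θ π p.1) p.2) •
    modelVecR θ π p.1

/-- `reflMap` is the reflection along the model vector. [cite: Iversen1992, Ch. I §2 (2.1)] -/
theorem reflMap_eq (ρ : K3Index → ℝ) (z : K3Index → ℂ) :
    reflMap θ π (ρ, z) = reflection k3FormC (modelVecR θ π ρ) z := by
  rw [reflection_apply, k3FormC_apply, k3FormC_apply, reflMap]

/-- The square of the model vector is continuous in the parameter. [folklore] -/
theorem continuous_k3Form_modelVecR :
    Continuous (fun p : (K3Index → ℝ) × (K3Index → ℂ) => k3Form (modelVecR θ π p.1) (modelVecR θ π p.1)) := by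
  have hM : Continuous (fun p : (K3Index → ℝ) × (K3Index → ℂ) => modelVecR θ π p.1) :=
    continuous_modelVecR.comp continuous_fst
  change Continuous ((fun q : (K3Index → ℂ) × (K3Index → ℂ) => k3Form q.1 q.2) ∘
    fun p : (K3Index → ℝ) × (K3Index → ℂ) => (modelVecR θ π p.1, modelVecR θ π p.1))
  exact continuous_k3Form₂.comp (hM.prodMk hM)

/-- The parametrised reflection is jointly continuous where the model vector is non-isotropic. [folklore] -/
theorem continuousAt_reflMap {ρ : K3Index → ℝ} {z : K3Index → ℂ}
    (h : k3Form (modelVecR θ π ρ) (modelVecR θ π ρ) ≠ 0) : ContinuousAt (reflMap θ π) (ρ, z) := by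
  have hM : Continuous (fun p : (K3Index → ℝ) × (K3Index → ℂ) => modelVecR θ π p.1) :=
    continuous_modelVecR.comp continuous_fst
  have h2 : Continuous (fun p : (K3Index → ℝ) × (K3Index → ℂ) => k3Form (modelVecR θ π p.1) p.2) := by
    change Continuous ((fun q : (K3Index → ℂ) × (K3Index → ℂ) => k3Form q.1 q.2) ∘
      fun p : (K3Index → ℝ) × (K3Index → ℂ) => (modelVecR θ π p.1, p.2))
    exact continuous_k3Form₂.comp (hM.prodMk continuous_snd)
  have h' : (fun p : (K3Index → ℝ) × (K3Index → ℂ) =>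
      k3Form (modelVecR θ π p.1) (modelVecR θ π p.1)) (ρ, z) ≠ 0 := h
  have hc : ContinuousAt ((fun _ : (K3Index → ℝ) × (K3Index → ℂ) => (2 : ℂ)) /
      (fun p : (K3Index → ℝ) × (K3Index → ℂ) => k3Form (modelVecR θ π p.1) (modelVecR θ π p.1)) *
      fun p : (K3Index → ℝ) × (K3Index → ℂ) => k3Form (modelVecR θ π p.1) p.2) (ρ, z) :=
    (ContinuousAt.div continuousAt_const continuous_k3Form_modelVecR.continuousAt h').mul h2.continuousAt
  have hs := continuous_snd.continuousAt.sub (hc.smul hM.continuousAt) (x := (ρ, z))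
  convert hs using 1
  funext p
  rfl

/-- Rational points are dense in `ℝ^{22}`. [folklore] -/
theorem exists_ratCast_mem_of_isOpen {O : Set (K3Index → ℝ)} (hO : IsOpen O) {ρ : K3Index → ℝ}
    (hρ : ρ ∈ O) : ∃ q : K3Index → ℚ, (fun i => (q i : ℝ)) ∈ O := by
  have hd : Dense (Set.pi Set.univ fun _ : K3Index => Set.range (Rat.cast : ℚ → ℝ)) :=
    dense_pi Set.univ fun _ _ => Rat.denseRange_cast
  obtain ⟨x, hx, hxO⟩ := hd.exists_mem_open hO ⟨ρ, hρ⟩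
  rw [Set.mem_pi] at hx
  choose q hq using fun i => hx i (Set.mem_univ i)
  refine ⟨q, ?_⟩
  convert hxO using 1
  funext i
  exact hq i

/-- **Approximation step (induction on the word)**: for a word of reflections along non-isotropic real
`e`-eigenvectors and an `e`-eigenvector `x`, every neighbourhood of `s_{n_k}⋯s_{n_1} x` contains `g x`
for some `g ∈ G_θ(ℚ)` — replace each `s_{n}` by the rational symmetry `R_{θq} ⊗ ℂ` with `q` rational
near the real coordinates of `n`, which acts on the eigenspace as the reflection along the nearby model
vector. [cite: Omeara1963, §42] [cite: Iversen1992, Ch. I §2] -/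
theorem exists_good_apply_mem
    (hθsa : ∀ a b : K3Index → ℂ, k3Form (thetaC θ a) b = k3Form a (thetaC θ b)) (he : e ≠ 0)
    (hπe : π.eval (e : ℂ) = 1)
    (hπW : ∀ y : K3Index → ℂ,
      thetaC θ (aeval (thetaC θ) π (thetaC θ y)) = (e : ℂ) • aeval (thetaC θ) π (thetaC θ y))
    (hT : ∀ z : K3Index → ℚ, z ∈ LinearMap.range (Matrix.toLin' θ) →
      (∀ x : K3Index → ℂ, thetaC θ x = (e : ℂ) • x → k3Form (fun i => (z i : ℂ)) x = 0) →
      k3FormRat z z = 0 → z = 0)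
    (l : List (K3Index → ℂ)) (hl : ∀ n ∈ l, k3Form n n ≠ 0 ∧ star n = n ∧ thetaC θ n = (e : ℂ) • n)
    {x : K3Index → ℂ} (hx : thetaC θ x = (e : ℂ) • x) {U : Set (K3Index → ℂ)} (hU : IsOpen U)
    (hmem : (l.map (reflection k3FormC)).prod x ∈ U) :
    ∃ g : Module.End ℂ (K3Index → ℂ), Good[θ, g] ∧ g x ∈ U := by
  induction l generalizing U with
  | nil =>
    refine ⟨LinearMap.id, ⟨fun a b => rfl, fun v => ⟨fun i => (v i : ℚ), ?_⟩, rfl⟩, by simpa using hmem⟩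
    rw [LinearMap.id_apply, intCast_eq_ratCast_intCast]
  | cons n l ih =>
    have hn := hl n List.mem_cons_self
    have hl' : ∀ m ∈ l, k3Form m m ≠ 0 ∧ star m = m ∧ thetaC θ m = (e : ℂ) • m :=
      fun m hm => hl m (List.mem_cons_of_mem n hm)
    rw [List.map_cons, List.prod_cons, Module.End.mul_apply] at hmem
    set x' := (l.map (reflection k3FormC)).prod x with hx'def
    have hx' : thetaC θ x' = (e : ℂ) • x' := prod_reflections_eigen (fun m hm => (hl' m hm).2.2) hx
    -- the real coordinates of `n` and the model vector there
    set ρ₀ : K3Index → ℝ := fun i => (n i).re with hρ₀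
    have hnρ : (fun i => (ρ₀ i : ℂ)) = n := reV_eq_self_of_star_eq hn.2.1
    have hM₀ : modelVecR θ π ρ₀ = (e : ℂ) • n := by
      rw [modelVecR, hnρ, hn.2.2, map_smul, aeval_apply_of_eigen hn.2.2, hπe, one_smul]
    have he' : (e : ℂ) ≠ 0 := by exact_mod_cast he
    have hM₀nn : k3Form (modelVecR θ π ρ₀) (modelVecR θ π ρ₀) ≠ 0 := by
      rw [hM₀, k3Form_smul_left, k3Form_smul_right]
      exact mul_ne_zero he' (mul_ne_zero he' hn.1)
    have hrefl₀ : reflMap θ π (ρ₀, x') = reflection k3FormC n x' := by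
      rw [reflMap_eq, hM₀, reflection_smul _ he']
    -- a product neighbourhood on which the parametrised reflection stays in `U`
    set S : Set ((K3Index → ℝ) × (K3Index → ℂ)) :=
      {p | k3Form (modelVecR θ π p.1) (modelVecR θ π p.1) ≠ 0} ∩ reflMap θ π ⁻¹' U with hS
    have hS₀ : S ∈ nhds (ρ₀, x') := by
      refine Filter.inter_mem ?_ ?_
      · exact (isOpen_ne.preimage continuous_k3Form_modelVecR).mem_nhds hM₀nn
      · exact continuousAt_reflMap hM₀nn (hU.mem_nhds (by rw [hrefl₀]; exact hmem))
    obtain ⟨O₁, hO₁, U₁, hU₁, hprod⟩ := mem_nhds_prod_iff.1 hS₀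
    obtain ⟨O₁', hO₁'sub, hO₁'open, hρO₁'⟩ := mem_nhds_iff.1 hO₁
    obtain ⟨U₁', hU₁'sub, hU₁'open, hxU₁'⟩ := mem_nhds_iff.1 hU₁
    obtain ⟨q, hq⟩ := exists_ratCast_mem_of_isOpen hO₁'open hρO₁'
    obtain ⟨g', hg', hg'x⟩ := ih hl' hU₁'open hxU₁'
    have hgx : thetaC θ (g' x) = (e : ℂ) • g' x := by
      have h := LinearMap.congr_fun hg'.2.2 x
      simp only [LinearMap.comp_apply] at h
      rw [← h, hx, map_smul]
    have hmemS : ((fun i => (q i : ℝ)), g' x) ∈ S := hprod (Set.mk_mem_prod (hO₁'sub hq) (hU₁'sub hg'x))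
    obtain ⟨hwq, hUq⟩ := hmemS
    simp only [Set.mem_setOf_eq, modelVecR_ratCast] at hwq
    rw [Set.mem_preimage, reflMap_eq, modelVecR_ratCast] at hUq
    have hZ := nondegenerate_restrict_cycQ hθsa hπe hπW hT q hwq
    refine ⟨ratSymmC (θ.mulVec q) hZ ∘ₗ g', ⟨?_, ?_, ?_⟩, ?_⟩
    · intro a b
      rw [LinearMap.comp_apply, LinearMap.comp_apply, ratSymmC_isometry, hg'.1]
    · intro v
      obtain ⟨w, hw⟩ := hg'.2.1 v
      exact ⟨ratSymm (θ.mulVec q) hZ w, by rw [LinearMap.comp_apply, hw, ratSymmC_ratCast]⟩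
    · rw [LinearMap.comp_assoc, hg'.2.2, ← LinearMap.comp_assoc, ratSymmC_comm hZ hθsa,
        LinearMap.comp_assoc]
    · rw [LinearMap.comp_apply, ratSymmC_apply_of_eigen hθsa hπe hπW q hZ hwq hgx]
      exact hUq

/-! ### §8 The Hodge-index input `hT` from a positive vector killed by `θ` -/

/-- **Rational vectors of `θ(Λ_ℚ)` orthogonal to the `e`-eigenspace are anisotropic** when `θ` kills a
rational vector of positive square and the `e`-eigenspace contains a period point (`(y.y) = 0`,
`(ȳ.y) > 0`): such a vector is orthogonal to the positive `3`-space `⟨u, Re y, Im y⟩` of `Λ_ℝ`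
(signature `(3,19)`), hence of negative square unless zero — Hodge index.
[cite: Huybrechts2016K3, Ch. 1 Prop. 2.4 (p. 19) and Ch. 3 Lemma 3.1 (p. 62–63)] -/
theorem eq_zero_of_mem_range_of_ortho_eigen
    (hθsa : ∀ a b : K3Index → ℂ, k3Form (thetaC θ a) b = k3Form a (thetaC θ b)) (he : e ≠ 0)
    {y₀ : K3Index → ℂ} (hy₀ : thetaC θ y₀ = (e : ℂ) • y₀) (h₀₀ : k3Form y₀ y₀ = 0)
    (h₀p : 0 < (k3Form (star y₀) y₀).re)
    {u : K3Index → ℚ} (hu0 : θ.mulVec u = 0) (hupos : 0 < k3FormRat u u)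
    {z : K3Index → ℚ} (hz : z ∈ LinearMap.range (Matrix.toLin' θ))
    (hzW : ∀ x : K3Index → ℂ, thetaC θ x = (e : ℂ) • x → k3Form (fun i => (z i : ℂ)) x = 0)
    (hzz : k3FormRat z z = 0) : z = 0 := by
  classical
  by_contra hz0
  obtain ⟨hC, hAB, hA⟩ := k3Period_re_im h₀₀ h₀p
  -- the real form and the period plane (cf. `Huybrechts2016_K3_transcendentalLattice_signature_holds`)
  set BR : LinearMap.BilinForm ℝ (K3Index → ℝ) := Matrix.toBilin' (k3Gram.map (Int.cast : ℤ → ℝ)) with hBR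
  set xr : K3Index → ℝ := fun i => (y₀ i).re with hxr
  set xi : K3Index → ℝ := fun i => (y₀ i).im with hxi
  have hRxx : 0 < BR xr xr := by rw [hBR, toBilin'_k3Gram_real_apply]; exact hA
  have hRyy : 0 < BR xi xi := by rw [hBR, toBilin'_k3Gram_real_apply, ← hAB]; exact hA
  have hRxy : BR xr xi = 0 := by rw [hBR, toBilin'_k3Gram_real_apply]; exact hC
  have hRs : BR.IsSymm := by
    rw [hBR]
    exact Matrix.isSymm_toBilin'_iff_isSymm.mpr (Matrix.IsSymm.map k3Gram_transpose _)
  have hRnd : BR.Nondegenerate := by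
    rw [hBR]
    refine LinearMap.BilinForm.nondegenerate_toBilin'_of_det_ne_zero' _ ?_
    have h : (k3Gram.map (Int.cast : ℤ → ℝ)).det = ((k3Gram.det : ℤ) : ℝ) := (Int.cast_det k3Gram).symm
    rw [h, k3Gram_det]
    norm_num
  have h3 : ∀ W : Submodule ℝ (K3Index → ℝ), (BR.toQuadraticMap.restrict W).PosDef →
      Module.finrank ℝ W ≤ 3 := fun W hW => finrank_le_three_of_posDef_k3 W (by rw [← hBR]; exact hW)
  have hQR : ∀ v w : K3Index → ℚ,
      BR (fun i => (v i : ℝ)) (fun i => (w i : ℝ)) = ((k3FormRat v w : ℚ) : ℝ) := by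
    intro v w
    rw [hBR, toBilin'_k3Gram_real_apply, k3FormRat_apply]
    push_cast
    rfl
  obtain ⟨M, hM⟩ : ∃ M : Submodule ℚ (K3Index → ℚ), ∀ v, v ∈ M ↔
      BR (fun i => (v i : ℝ)) xr = 0 ∧ BR (fun i => (v i : ℝ)) xi = 0 :=
    ⟨{ carrier := {v | BR (fun i => (v i : ℝ)) xr = 0 ∧ BR (fun i => (v i : ℝ)) xi = 0}
       add_mem' := fun {v w} hv hw => by
         simp only [Set.mem_setOf_eq] at hv hw ⊢
         rw [ratCast_add, map_add, LinearMap.add_apply, LinearMap.add_apply, hv.1, hw.1, hv.2, hw.2]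
         simp
       zero_mem' := by
         simp only [Set.mem_setOf_eq]
         have h0 : (fun i => ((0 : K3Index → ℚ) i : ℝ)) = 0 := by funext i; simp
         rw [h0, map_zero, LinearMap.zero_apply, LinearMap.zero_apply]
         exact ⟨rfl, rfl⟩
       smul_mem' := fun c v hv => by
         simp only [Set.mem_setOf_eq] at hv ⊢
         rw [ratCast_smul, map_smul, LinearMap.smul_apply, LinearMap.smul_apply, hv.1, hv.2]
         simp }, fun v => Iff.rfl⟩
  have hMiff : ∀ v : K3Index → ℚ, v ∈ M ↔ k3Form (fun i => ((v i : ℚ) : ℂ)) y₀ = 0 := by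
    intro v
    rw [hM, hBR, ratCast_orthogonal_re_im_iff]
  -- `u ∈ M`: `u ⊥ y₀` since `θ u = 0`, `θ y₀ = e y₀`, `e ≠ 0`
  have he' : (e : ℂ) ≠ 0 := by exact_mod_cast he
  have huy : k3Form (fun i => (u i : ℂ)) y₀ = 0 := by
    have h := hθsa (fun i => (u i : ℂ)) y₀
    rw [thetaC_ratCast, hu0, hy₀, k3Form_smul_right] at h
    have h0 : k3Form (fun i => ((0 : K3Index → ℚ) i : ℂ)) y₀ = 0 := by
      have : (fun i => ((0 : K3Index → ℚ) i : ℂ)) = 0 := by funext i; simp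
      rw [this, k3Form_zero_left]
    rw [h0] at h
    exact (mul_eq_zero.1 h.symm).resolve_left he'
  have huM : u ∈ M := (hMiff u).2 huy
  have hzM : z ∈ M := (hMiff z).2 (hzW y₀ hy₀)
  have huz : k3FormRat u z = 0 := by
    obtain ⟨z', rfl⟩ := hz
    rw [← selfAdjoint_rat hθsa, Matrix.toLin'_apply, hu0, map_zero, LinearMap.zero_apply]
  have hneg := apply_self_neg_of_mem_of_ortho hQR hRs hRnd h3 hRxx hRyy hRxy hM huM hupos hzM huz hz0
  rw [hzz] at hneg
  exact lt_irrefl _ hneg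

/-! ### §9 RATIONAL ORBIT DENSITY on the Hodge locus `D_{θ,e}` -/

/-- **Rational orbit density.** Let `θ ∈ M₂₂(ℚ)` be `k3Form`-self-adjoint, `e ≠ 0` real, `π ∈ ℂ[X]`
with `π(e) = 1` and `(θ_ℂ − e)·π(θ_ℂ)·θ_ℂ = 0` (the `e`-eigenprojector on `θ(Λ)`), and suppose `θ` kills a
rational vector of positive square. Then for every period point `y₀` of the Hodge locus
`D_{θ,e} = {y : θ_ℂ y = e y, (y.y) = 0, (ȳ.y) > 0}` and every open `U ⊂ Λ_ℂ` containing a point `y₁` of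
`D_{θ,e}`, there is an isometry `g` of `(Λ_ℂ, k3Form)` DEFINED OVER `ℚ` and COMMUTING WITH `θ_ℂ`, and a
scalar `c ≠ 0`, with `c·g(y₀) ∈ U`: the orbits of the rational centraliser `G_θ(ℚ)` on `D_{θ,e}` are
dense. Fact-free. [cite: Omeara1963, §42 and §43B] [cite: Iversen1992, Ch. I §2 Prop. 2.3]
[cite: Huybrechts2016K3, Ch. 6 Prop. 1.5 and Ch. 3 Lemma 3.1] -/
theorem exists_ratIsometry_commute_smul_mem_of_isOpen
    (hθsa : ∀ a b : K3Index → ℂ, k3Form (thetaC θ a) b = k3Form a (thetaC θ b)) (he : e ≠ 0)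
    (hπe : π.eval (e : ℂ) = 1)
    (hπW : ∀ y : K3Index → ℂ,
      thetaC θ (aeval (thetaC θ) π (thetaC θ y)) = (e : ℂ) • aeval (thetaC θ) π (thetaC θ y))
    (hu : ∃ u : K3Index → ℚ, θ.mulVec u = 0 ∧ 0 < k3FormRat u u)
    {y₀ : K3Index → ℂ} (hy₀ : thetaC θ y₀ = (e : ℂ) • y₀) (h₀₀ : k3Form y₀ y₀ = 0)
    (h₀p : 0 < (k3Form (star y₀) y₀).re)
    {U : Set (K3Index → ℂ)} (hU : IsOpen U) {y₁ : K3Index → ℂ} (hy₁U : y₁ ∈ U)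
    (hy₁ : thetaC θ y₁ = (e : ℂ) • y₁) (h₁₁ : k3Form y₁ y₁ = 0) (h₁p : 0 < (k3Form (star y₁) y₁).re) :
    ∃ (g : Module.End ℂ (K3Index → ℂ)) (c : ℂ), c ≠ 0 ∧
      (∀ a b : K3Index → ℂ, k3Form (g a) (g b) = k3Form a b) ∧
      (∀ v : K3Index → ℤ, ∃ w : K3Index → ℚ, g (fun i => (v i : ℂ)) = fun i => (w i : ℂ)) ∧
      g ∘ₗ thetaC θ = thetaC θ ∘ₗ g ∧ c • g y₀ ∈ U := by
  obtain ⟨u, hu0, hupos⟩ := hu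
  have hT : ∀ z : K3Index → ℚ, z ∈ LinearMap.range (Matrix.toLin' θ) →
      (∀ x : K3Index → ℂ, thetaC θ x = (e : ℂ) • x → k3Form (fun i => (z i : ℂ)) x = 0) →
      k3FormRat z z = 0 → z = 0 :=
    fun z hz hzW hzz => eq_zero_of_mem_range_of_ortho_eigen hθsa he hy₀ h₀₀ h₀p hu0 hupos hz hzW hzz
  have hereal : star (e : ℂ) = e := Complex.conj_ofReal e
  obtain ⟨l, r, hr, hl, hprod⟩ := exists_reflections_prod_eq_smul hereal hy₀ h₀₀ h₀p hy₁ h₁₁ h₁p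
  have hr' : (r : ℂ) ≠ 0 := by exact_mod_cast hr.ne'
  set U' : Set (K3Index → ℂ) := (fun z => (r : ℂ)⁻¹ • z) ⁻¹' U with hU'def
  have hU' : IsOpen U' := hU.preimage (continuous_const_smul _)
  have hmem : (l.map (reflection k3FormC)).prod y₀ ∈ U' := by
    rw [hU'def, Set.mem_preimage, hprod, smul_smul, inv_mul_cancel₀ hr', one_smul]
    exact hy₁U
  obtain ⟨g, hg, hgU⟩ := exists_good_apply_mem hθsa he hπe hπW hT l hl hy₀ hU' hmem
  exact ⟨g, (r : ℂ)⁻¹, inv_ne_zero hr', hg.1, hg.2.1, hg.2.2, hgU⟩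

end Density

end Summit.HodgeConjecture.HodgeConjecture.Theorems.MarkmanPartnerTransport.RMTypeOrbit

end
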